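/-
Copyright (c) 2026 the pub-hodgecm-mathlib formalisation cell (harness21).  Prover seat hodgecm-mathlib-K2E1-p12 (g0), Track B ∕ K2-LIT (build stream 29),
h413 = `stmt-HodgeConjecture-24833`, line `K2_E1_TraceFormulaBeta`, 5Res campaign, rung R8₂-sph «EXHAUSTION» (ROADCARD `K2/K2E1-p09/g6/ROADCARD-R8-EXHAUSTION-SPH-2.K2E1-p09-g6.md`,
ROAD T′, step T6), dealer K2E1-plan (g6) deal (80) 2026-09-04T10:34:42Z: THE ABSTRACT «NO EIGENVECTORS OF MULTIPLICATION OPERATORS» LEMMA (EIGEN-VERSION OF T6), Mathlib only.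
-/
import Mathlib.MeasureTheory.Function.LpSpace.Basic
import Mathlib.MeasureTheory.Measure.Typeclasses.NullSingletonClass
import Mathlib.LinearAlgebra.Eigenspace.Triangularizable
import HarnessLib

/-!
# K2·E1 — `K2E1ProjectionCommutingMultiplicationOperators` (R8₂-sph, ROAD T′, step T6 — EIGEN-VERSION): A MULTIPLICATION OPERATOR WITH NULL LEVEL SETS HAS NO EIGENVECTORS; ON
# `E ⊕ L²(X)` EVERY COMMON EIGENVECTOR OF `(κ, M_λ)` IS «CONSTANT»; A FINITE-DIMENSIONAL STABLE SUBSPACE WITHOUT EIGENVECTORS IS ZERO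

Track B ∕ K2-LIT, crux h413 = `stmt-HodgeConjecture-24833`, route of record `HCCMUnconditional`; cell `hodgecm-mathlib`, squad K2, ENGINE E1.  THEOREMS ONLY (no `def`, no `instance`, no
notation, no named-fact hypothesis, no `sorry`; default heartbeats); lane `--kind proof --supports stmt-HodgeConjecture-24833 --as helper` (count-neutral).  MATHLIB ONLY — no automorphic
input; this is the measure-theory ∕ linear-algebra kernel of the R8₂ exhaustion «the `Re z = ½` direct integral carries no `L²_disc` vector» (K2E4-p23 (g2)'s 5Res census (2)(iii) ∕ (3)(f5);
ROADCARD T6, eigen-version first per (80) since admissibility of a residual `Π` is ★ `finiteDimensional_of_reg_exp`).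

THE MATHEMATICS [ReedSimonI1980, §VII.2 (multiplication operators; Thm. VII.? «`M_φ` has pure point `λ` iff `ν{φ = λ} > 0`»); Borel1997, §§11–13; Iwaniec2002, §7 (p. 103)].  If
`λ(x)·f(x) = c·f(x)` a.e. then `(λ(x) − c)·f(x) = 0` a.e., so `f = 0` a.e. OFF the level set `{λ = c}` (§1); if that level set is `ν`-null — e.g. COUNTABLE for a measure without atoms,
which is the case for the level sets of a non-constant real-analytic multiplier such as `t ↦ ĥ(½ + it)` (step T7) — then `f = 0` a.e.: a multiplication operator with null level sets
has NO eigenvectors.  For a countable family `(λ_j)` the joint statement holds with the joint level set `{∀ j, λ_j = c_j}`, null as soon as the family separates points (§2).  On the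
model space `E ⊕ L²(X)` of the spherical Plancherel map (T5: the constant line `⊕` the `Re z = ½` integral, `R(h)` acting by `(ĥ(1), M_{ĥ(½+i·)})`), a common eigenvector `(a, f)` has
`a = 0` or eigenvalues `c_j = κ_j`, and in the latter case `f` lives on `{∀ j, λ_j = κ_j}`; so if the joint level sets are null, EVERY common eigenvector is `(a, 0)` — «constant» (§3).
Finally (§4), a finite-dimensional `M`-stable subspace on which `M` has no eigenvector is `0` (an endomorphism of a nonzero finite-dimensional space over an algebraically closed field
has an eigenvalue, Mathlib `Module.End.exists_eigenvalue`) — the door through which ADMISSIBILITY (`Π^K` finite-dimensional, ★ `finiteDimensional_of_reg_exp`) enters T9.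

* §1 `ae_eq_zero_of_ae_smul_eq_smul` (off the level set), `…_of_null`, `…_of_countable`; scalar versions `ae_eq_zero_of_ae_mul_eq_mul[_of_null ∕ _of_countable]`.
* §2 (countable families) `ae_forall_eq_of_ae_smul_eq_smul`, `ae_eq_zero_of_ae_smul_eq_smul_of_joint_null`, `subsingleton_setOf_forall_eq_of_separatesPoints`,
  `ae_eq_zero_of_ae_smul_eq_smul_of_separatesPoints`.
* §3 (the `E ⊕ L²` shape) **`fst_eq_zero_or_snd_ae_eq_zero`**, **`snd_ae_eq_zero_of_joint_null`** (every common eigenvector is «constant»).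
* §4 (linear algebra) **`submodule_eq_bot_of_invariant_of_forall_eigenvector_eq_zero`**.
* §5 (`Lp` corollaries) `lp_eq_zero_of_ae_smul_eq_smul_of_null`, `lp_eq_zero_of_ae_smul_eq_smul_of_countable`.
DEFERRED (not needed on the admissible road; say so on the bus if T9 wants it): the literal PROJECTION form of T6 «an orthogonal projection commuting with all `M_λ` is `M_{𝟙_S}`».
HONEST LABEL: HC_CM is proved only modulo the 7 printed citations (2 remaining named inputs: hLiu418 = `stmt-HodgeConjecture-24832`, h413 = `stmt-HodgeConjecture-24833`) until rung 0
closes; this file asserts no named fact, closes no socket and crosses no ceiling by itself; count-neutral.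

## References
* [ReedSimonI1980] M. Reed, B. Simon, *Methods of Modern Mathematical Physics I: Functional Analysis* (rev. ed. 1980), §VII.2 (multiplication operators and their point spectrum).
* [Iwaniec2002] H. Iwaniec, *Spectral Methods of Automorphic Forms*, 2nd ed., GSM 53 (2002), §7 (spectral decomposition of incomplete Eisenstein series; p. 103).
* [Borel1997] A. Borel, *Automorphic Forms on SL₂(ℝ)*, Cambridge Tracts in Math. 130 (1997), §§11–13 (Maass–Selberg, the continuous spectrum carries no discrete vectors).
-/

set_option autoImplicit false
-- the mandated namespace repeats `HodgeConjecture.HodgeConjecture`, as in every `Theorems/*.lean` of this sub-problem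
set_option linter.dupNamespace false

noncomputable section

open MeasureTheory Set Filter
open scoped ENNReal

namespace Summit.HodgeConjecture.HodgeConjecture.Cruxes.H413.K2E1ProjectionCommutingMultiplicationOperators

/-! ## §1 One multiplier: `λ·f = c·f` a.e. forces `f = 0` a.e. off `{λ = c}`; null level set ⇒ `f = 0` a.e. -/

section One

variable {X : Type*} [MeasurableSpace X] {ν : Measure X} {𝕜 : Type*} [Field 𝕜] {E : Type*} [AddCommGroup E] [Module 𝕜 E] [NoZeroSMulDivisors 𝕜 E]

/-- **OFF THE LEVEL SET AN EIGENFUNCTION OF A MULTIPLICATION OPERATOR VANISHES**: `λ(x)·f(x) = c·f(x)` a.e. ⇒ `f(x) = 0` for a.e. `x` with `λ(x) ≠ c` (`(λ(x) − c)·f(x) = 0`, no zero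
smul-divisors). [cite: ReedSimonI1980, §VII.2] -/
theorem ae_eq_zero_of_ae_smul_eq_smul {lam : X → 𝕜} {f : X → E} {c : 𝕜} (h : ∀ᵐ x ∂ν, lam x • f x = c • f x) : ∀ᵐ x ∂ν, lam x ≠ c → f x = 0 :=
  h.mono fun x hx hne => by
    have h0 : (lam x - c) • f x = 0 := by rw [sub_smul, hx, sub_self]
    exact (smul_eq_zero.1 h0).resolve_left (sub_ne_zero.2 hne)

/-- **NULL LEVEL SET ⇒ NO EIGENVECTOR**: `λ·f = c·f` a.e. and `ν{λ = c} = 0` ⇒ `f = 0` a.e. [cite: ReedSimonI1980, §VII.2] -/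
theorem ae_eq_zero_of_ae_smul_eq_smul_of_null {lam : X → 𝕜} {f : X → E} {c : 𝕜} (h : ∀ᵐ x ∂ν, lam x • f x = c • f x) (hc : ν {x | lam x = c} = 0) : f =ᵐ[ν] 0 := by
  have hc' : ∀ᵐ x ∂ν, lam x ≠ c := measure_eq_zero_iff_ae_notMem.1 hc
  filter_upwards [ae_eq_zero_of_ae_smul_eq_smul h, hc'] with x hx hne
  exact hx hne

/-- **COUNTABLE LEVEL SET, NO ATOMS ⇒ NO EIGENVECTOR** (the case of a non-constant real-analytic multiplier against a diffuse measure, e.g. `t ↦ ĥ(½+it)` on `L²(ℝ_{≥0}, w dt)`).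
[cite: ReedSimonI1980, §VII.2] [cite: Iwaniec2002, §7 (p. 103)] -/
theorem ae_eq_zero_of_ae_smul_eq_smul_of_countable [NullSingletonClass ν] {lam : X → 𝕜} {f : X → E} {c : 𝕜} (h : ∀ᵐ x ∂ν, lam x • f x = c • f x)
    (hc : {x | lam x = c}.Countable) : f =ᵐ[ν] 0 :=
  ae_eq_zero_of_ae_smul_eq_smul_of_null h (hc.measure_zero ν)

/-- Scalar edition (`𝕜`-valued `f`, products): `λ·f = c·f` a.e. ⇒ `f = 0` a.e. off `{λ = c}`. [cite: ReedSimonI1980, §VII.2] -/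
theorem ae_eq_zero_of_ae_mul_eq_mul {lam f : X → 𝕜} {c : 𝕜} (h : ∀ᵐ x ∂ν, lam x * f x = c * f x) : ∀ᵐ x ∂ν, lam x ≠ c → f x = 0 :=
  ae_eq_zero_of_ae_smul_eq_smul (E := 𝕜) (by simpa only [smul_eq_mul] using h)

/-- Scalar edition: null level set ⇒ `f = 0` a.e. [cite: ReedSimonI1980, §VII.2] -/
theorem ae_eq_zero_of_ae_mul_eq_mul_of_null {lam f : X → 𝕜} {c : 𝕜} (h : ∀ᵐ x ∂ν, lam x * f x = c * f x) (hc : ν {x | lam x = c} = 0) : f =ᵐ[ν] 0 :=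
  ae_eq_zero_of_ae_smul_eq_smul_of_null (E := 𝕜) (by simpa only [smul_eq_mul] using h) hc

/-- Scalar edition: countable level set and no atoms ⇒ `f = 0` a.e. [cite: ReedSimonI1980, §VII.2] -/
theorem ae_eq_zero_of_ae_mul_eq_mul_of_countable [NullSingletonClass ν] {lam f : X → 𝕜} {c : 𝕜} (h : ∀ᵐ x ∂ν, lam x * f x = c * f x)
    (hc : {x | lam x = c}.Countable) : f =ᵐ[ν] 0 :=
  ae_eq_zero_of_ae_mul_eq_mul_of_null h (hc.measure_zero ν)

end One

/-! ## §2 A countable family of multipliers: joint eigenfunctions live on the joint level set -/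

section Family

variable {X : Type*} [MeasurableSpace X] {ν : Measure X} {𝕜 : Type*} [Field 𝕜] {E : Type*} [AddCommGroup E] [Module 𝕜 E] [NoZeroSMulDivisors 𝕜 E]
  {ι : Type*} [Countable ι]

/-- **A JOINT EIGENFUNCTION LIVES ON THE JOINT LEVEL SET**: `λ_j·f = c_j·f` a.e. for every `j` of a countable family ⇒ a.e., `f(x) ≠ 0 → ∀ j, λ_j(x) = c_j`. [cite: ReedSimonI1980, §VII.2] -/
theorem ae_forall_eq_of_ae_smul_eq_smul {lam : ι → X → 𝕜} {f : X → E} {c : ι → 𝕜} (h : ∀ j, ∀ᵐ x ∂ν, lam j x • f x = c j • f x) :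
    ∀ᵐ x ∂ν, f x ≠ 0 → ∀ j, lam j x = c j := by
  have h' : ∀ᵐ x ∂ν, ∀ j, lam j x ≠ c j → f x = 0 := ae_all_iff.2 fun j => ae_eq_zero_of_ae_smul_eq_smul (h j)
  exact h'.mono fun x hx hf j => by_contra fun hne => hf (hx j hne)

/-- **NULL JOINT LEVEL SET ⇒ NO JOINT EIGENVECTOR**: `λ_j·f = c_j·f` a.e. (all `j`) and `ν{∀ j, λ_j = c_j} = 0` ⇒ `f = 0` a.e. [cite: ReedSimonI1980, §VII.2] -/
theorem ae_eq_zero_of_ae_smul_eq_smul_of_joint_null {lam : ι → X → 𝕜} {f : X → E} {c : ι → 𝕜} (h : ∀ j, ∀ᵐ x ∂ν, lam j x • f x = c j • f x)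
    (hnull : ν {x | ∀ j, lam j x = c j} = 0) : f =ᵐ[ν] 0 := by
  have h0 : ∀ᵐ x ∂ν, ¬ (∀ j, lam j x = c j) := measure_eq_zero_iff_ae_notMem.1 hnull
  filter_upwards [ae_forall_eq_of_ae_smul_eq_smul h, h0] with x hx hne
  by_contra hf
  exact hne (hx hf)

omit [MeasurableSpace X] [Field 𝕜] [Countable ι] in
/-- A family that SEPARATES POINTS has joint level sets with at most one point. [folklore] -/
theorem subsingleton_setOf_forall_eq_of_separatesPoints {lam : ι → X → 𝕜} (hsep : ∀ x y : X, (∀ j, lam j x = lam j y) → x = y) (c : ι → 𝕜) :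
    ({x | ∀ j, lam j x = c j} : Set X).Subsingleton :=
  fun x hx y hy => hsep x y fun j => (hx j).trans (hy j).symm

/-- **A POINT-SEPARATING COUNTABLE FAMILY OF MULTIPLIERS HAS NO JOINT EIGENVECTOR against a measure without atoms** (the roadcard's T6 eigen-version verbatim). [cite: ReedSimonI1980, §VII.2]
[cite: Borel1997, §13] -/
theorem ae_eq_zero_of_ae_smul_eq_smul_of_separatesPoints [NullSingletonClass ν] {lam : ι → X → 𝕜} {f : X → E} {c : ι → 𝕜}
    (h : ∀ j, ∀ᵐ x ∂ν, lam j x • f x = c j • f x) (hsep : ∀ x y : X, (∀ j, lam j x = lam j y) → x = y) : f =ᵐ[ν] 0 :=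
  ae_eq_zero_of_ae_smul_eq_smul_of_joint_null h ((subsingleton_setOf_forall_eq_of_separatesPoints hsep c).countable.measure_zero ν)

end Family

/-! ## §3 The `E ⊕ L²(X)` shape: every common eigenvector of `(a, f) ↦ (κ_j·a, λ_j·f)` is «constant» -/

section Pair

variable {X : Type*} [MeasurableSpace X] {ν : Measure X} {𝕜 : Type*} [Field 𝕜] {E : Type*} [AddCommGroup E] [Module 𝕜 E] [NoZeroSMulDivisors 𝕜 E]
  {ι : Type*} [Countable ι]

/-- **ON `E ⊕ (X → E)` A COMMON EIGENVECTOR `(a, f)` OF `(κ_j, M_{λ_j})` HAS `a = 0` OR `f = 0` A.E.**, granted the joint level set `{∀ j, λ_j = κ_j}` is null: if `a ≠ 0` the eigenvalues are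
forced to be `c_j = κ_j`, and then `f` lives on `{∀ j, λ_j = κ_j}` (§2). [cite: ReedSimonI1980, §VII.2] [cite: Iwaniec2002, §7 (p. 103)] -/
theorem fst_eq_zero_or_snd_ae_eq_zero {κ : ι → 𝕜} {lam : ι → X → 𝕜} {a : E} {f : X → E} {c : ι → 𝕜}
    (ha : ∀ j, κ j • a = c j • a) (hf : ∀ j, ∀ᵐ x ∂ν, lam j x • f x = c j • f x) (hκ : ν {x | ∀ j, lam j x = κ j} = 0) : a = 0 ∨ f =ᵐ[ν] 0 := by
  by_cases ha0 : a = 0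
  · exact Or.inl ha0
  · refine Or.inr ?_
    have hc : ∀ j, c j = κ j := fun j => by
      have h0 : (κ j - c j) • a = 0 := by rw [sub_smul, ha j, sub_self]
      exact (sub_eq_zero.1 ((smul_eq_zero.1 h0).resolve_right ha0)).symm
    refine ae_eq_zero_of_ae_smul_eq_smul_of_joint_null hf ?_
    simp only [hc]
    exact hκ

/-- **EVERY COMMON EIGENVECTOR IS «CONSTANT»**: if ALL joint level sets `{∀ j, λ_j = c_j}` are null (e.g. the family separates points of a diffuse `X`), a common eigenvector `(a, f)` of
`(κ_j, M_{λ_j})` has `f = 0` a.e. — it lies in `E × {0}`. [cite: ReedSimonI1980, §VII.2] [cite: Borel1997, §13] -/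
theorem snd_ae_eq_zero_of_joint_null {lam : ι → X → 𝕜} {f : X → E} {c : ι → 𝕜}
    (hf : ∀ j, ∀ᵐ x ∂ν, lam j x • f x = c j • f x) (hnull : ∀ c' : ι → 𝕜, ν {x | ∀ j, lam j x = c' j} = 0) : f =ᵐ[ν] 0 :=
  ae_eq_zero_of_ae_smul_eq_smul_of_joint_null hf (hnull c)

/-- The same with the extra coordinate displayed and point separation as the hypothesis (no atoms): `(a, f)` common eigenvector ⇒ `f = 0` a.e. [cite: ReedSimonI1980, §VII.2] -/
theorem snd_ae_eq_zero_of_separatesPoints [NullSingletonClass ν] {κ : ι → 𝕜} {lam : ι → X → 𝕜} {a : E} {f : X → E} {c : ι → 𝕜}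
    (_ha : ∀ j, κ j • a = c j • a) (hf : ∀ j, ∀ᵐ x ∂ν, lam j x • f x = c j • f x) (hsep : ∀ x y : X, (∀ j, lam j x = lam j y) → x = y) : f =ᵐ[ν] 0 :=
  ae_eq_zero_of_ae_smul_eq_smul_of_separatesPoints hf hsep

end Pair

/-! ## §4 Linear algebra: a finite-dimensional stable subspace without eigenvectors is zero (the admissibility door) -/

section LinAlg

variable {K : Type*} [Field K] [IsAlgClosed K] {V : Type*} [AddCommGroup V] [Module K V]

/-- **A FINITE-DIMENSIONAL `M`-STABLE SUBSPACE ON WHICH `M` HAS NO EIGENVECTOR IS `⊥`** (algebraically closed scalars): otherwise `M|_W` has an eigenvalue (Mathlib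
`Module.End.exists_eigenvalue`) and an eigenvector.  With `V = E ⊕ L²`, `M` a multiplier with null level sets (§1–§3) and `W = Π^K` finite-dimensional by admissibility, this is the
exhaustion step T9's kernel. [cite: ReedSimonI1980, §VII.2] [cite: Borel1997, §13] -/
theorem submodule_eq_bot_of_invariant_of_forall_eigenvector_eq_zero (M : V →ₗ[K] V) (W : Submodule K V) [FiniteDimensional K W]
    (hW : ∀ w ∈ W, M w ∈ W) (hno : ∀ (c : K), ∀ w ∈ W, M w = c • w → w = 0) : W = ⊥ := by
  by_contra hne
  haveI : Nontrivial W := Submodule.nontrivial_iff_ne_bot.2 hne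
  obtain ⟨c, hc⟩ := Module.End.exists_eigenvalue (M.restrict hW)
  obtain ⟨w, hw⟩ := hc.exists_hasEigenvector
  have hMw : M (w : V) = c • (w : V) := by
    have h := congrArg (Subtype.val : W → V) hw.apply_eq_smul
    simpa only [LinearMap.restrict_apply, Submodule.coe_smul] using h
  exact hw.2 (Subtype.ext (hno c w w.2 hMw))

/-- The same with the «no eigenvector» hypothesis stated on all of `V`. [cite: ReedSimonI1980, §VII.2] -/
theorem submodule_eq_bot_of_invariant_of_forall_eigenvector_eq_zero' (M : V →ₗ[K] V) (W : Submodule K V) [FiniteDimensional K W]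
    (hW : ∀ w ∈ W, M w ∈ W) (hno : ∀ (c : K) (v : V), M v = c • v → v = 0) : W = ⊥ :=
  submodule_eq_bot_of_invariant_of_forall_eigenvector_eq_zero M W hW fun c w _ h => hno c w h

end LinAlg

/-! ## §5 `Lp` corollaries -/

section LpCor

variable {X : Type*} [MeasurableSpace X] {ν : Measure X} {𝕜 : Type*} [NormedField 𝕜] {E : Type*} [NormedAddCommGroup E] [NormedSpace 𝕜 E] {p : ℝ≥0∞}

/-- **IN `Lp`: an eigenvector of a multiplication operator with null level set is `0`** (`Lp.eq_zero_iff_ae_eq_zero`). [cite: ReedSimonI1980, §VII.2] -/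
theorem lp_eq_zero_of_ae_smul_eq_smul_of_null (f : Lp E p ν) {lam : X → 𝕜} {c : 𝕜} (h : ∀ᵐ x ∂ν, lam x • (f : X → E) x = c • (f : X → E) x)
    (hc : ν {x | lam x = c} = 0) : f = 0 :=
  Lp.eq_zero_iff_ae_eq_zero.2 (ae_eq_zero_of_ae_smul_eq_smul_of_null h hc)

/-- In `Lp`, countable level set and no atoms ⇒ the eigenvector is `0`. [cite: ReedSimonI1980, §VII.2] [cite: Iwaniec2002, §7 (p. 103)] -/
theorem lp_eq_zero_of_ae_smul_eq_smul_of_countable [NullSingletonClass ν] (f : Lp E p ν) {lam : X → 𝕜} {c : 𝕜}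
    (h : ∀ᵐ x ∂ν, lam x • (f : X → E) x = c • (f : X → E) x) (hc : {x | lam x = c}.Countable) : f = 0 :=
  lp_eq_zero_of_ae_smul_eq_smul_of_null f h (hc.measure_zero ν)

/-- In `Lp`, a joint eigenvector of a countable point-separating family of multipliers (no atoms) is `0`. [cite: ReedSimonI1980, §VII.2] [cite: Borel1997, §13] -/
theorem lp_eq_zero_of_ae_smul_eq_smul_of_separatesPoints [NullSingletonClass ν] {ι : Type*} [Countable ι] (f : Lp E p ν) {lam : ι → X → 𝕜} {c : ι → 𝕜}
    (h : ∀ j, ∀ᵐ x ∂ν, lam j x • (f : X → E) x = c j • (f : X → E) x) (hsep : ∀ x y : X, (∀ j, lam j x = lam j y) → x = y) : f = 0 :=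
  Lp.eq_zero_iff_ae_eq_zero.2 (ae_eq_zero_of_ae_smul_eq_smul_of_separatesPoints h hsep)

end LpCor

end Summit.HodgeConjecture.HodgeConjecture.Cruxes.H413.K2E1ProjectionCommutingMultiplicationOperators

end
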